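import Mathlib
import HarnessLib
import Summits.KontsevichZagierPeriods.Zeta5Search.Denom.CatalanRayDigits

/-!
# ζ(5) search — digit inequalities behind the odd denominators on the Catalan-box rays, Part B for types β, γ (cell `pub-zeta5`, fam-denom K6)
HONEST FRAMING: systematic search; no irrationality claim unless certified. Nothing in this file mentions Catalan's
constant or an irrationality statement; it is elementary arithmetic of residues.

Continuation of `Denom/CatalanRayDigits.lean` (its module docstring is the plan of the three files; CATK6.md §3–§5):
generic one-level Legendre lemmas over `ℕ`-division cast to `ℤ`, and the floor-form identities `HdigFloor_eq`
(type β / βA′: `1 ≤ a ≤ n ≤ X`) and `GdigFloor_eq` (type γ: `n < a ≤ 2n`) with their sign consequences.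
-/

namespace Summit.KontsevichZagierPeriods.Zeta5Search.Denom.CatalanRayDigits

/-! ### Part B continued — generic one-level Legendre lemmas and the transcriptions for types β, γ

Generic lemmas over `ℕ`-division cast to `ℤ` (`q > 0` a prime power in the application; `q` odd where stated),
then `HdigFloor_eq` (type β / βA′: `1 ≤ a ≤ n ≤ X`, `X = a + jn`) and `GdigFloor_eq` (type γ: `n < a ≤ 2n`). -/

/-- `⌊2N/q⌋ = 2⌊N/q⌋ + θ_q(N mod q)`. -/
lemma two_mul_div (q N : ℕ) (hq : 0 < q) :
    (((2 * N) / q : ℕ) : ℤ) = 2 * ((N / q : ℕ) : ℤ) + th q (N % q) := by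
  have h := Nat.div_add_mod N q
  have hr := Nat.mod_lt N hq
  have e : 2 * N = q * (2 * (N / q)) + 2 * (N % q) := by
    have : q * (2 * (N / q)) = 2 * (q * (N / q)) := by ring
    omega
  rw [e, cdiv4 q _ _ hq (by omega)]
  unfold th ind
  push_cast
  split_ifs <;> omega

/-- `⌊(A+B)/q⌋ = ⌊A/q⌋ + ⌊B/q⌋ +` the carry `[q ≤ A mod q + B mod q]` (cast to `ℤ`). -/
lemma add_div_cast (q A B : ℕ) (hq : 0 < q) :
    (((A + B) / q : ℕ) : ℤ) = ((A / q : ℕ) : ℤ) + ((B / q : ℕ) : ℤ) + ind (q ≤ A % q + B % q) := by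
  have hA := Nat.div_add_mod A q
  have hB := Nat.div_add_mod B q
  have hrA := Nat.mod_lt A hq
  have hrB := Nat.mod_lt B hq
  have e : A + B = q * (A / q + B / q) + (A % q + B % q) := by rw [mul_add]; omega
  rw [e, cdiv4 q _ _ hq (by omega)]
  unfold ind
  push_cast
  split_ifs <;> omega

/-- `(A + B) mod q` as the wrapped sum of the residues. -/
lemma add_mod_wrap (q A B : ℕ) (hq : 0 < q) :
    (A + B) % q = if A % q + B % q < q then A % q + B % q else A % q + B % q - q := by
  have hrA := Nat.mod_lt A hq
  have hrB := Nat.mod_lt B hq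
  rw [Nat.add_mod]
  split_ifs with h
  · exact Nat.mod_eq_of_lt h
  · rw [Nat.mod_eq_sub_mod (show q ≤ A % q + B % q by omega),
      Nat.mod_eq_of_lt (show A % q + B % q - q < q by omega)]

/-- `2B mod q` as the wrapped double of the residue. -/
lemma two_mul_mod_wrap (q B : ℕ) (hq : 0 < q) :
    (2 * B) % q = if 2 * (B % q) < q then 2 * (B % q) else 2 * (B % q) - q := by
  rw [two_mul, add_mod_wrap q B B hq, ← two_mul]

/-- The carry of `A + B` at `q` is detected by `(A+B) mod q < A mod q`. -/
lemma wrap_lt (q A B : ℕ) (hq : 0 < q) : ind ((A + B) % q < A % q) = ind (q ≤ A % q + B % q) := by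
  have hrA := Nat.mod_lt A hq
  have hrB := Nat.mod_lt B hq
  rw [add_mod_wrap q A B hq]
  unfold ind
  split_ifs <;> omega

/-- `⌊(b−1)/q⌋ = ⌊b/q⌋ − [q ∣ b]` for `b ≥ 1`. -/
lemma pred_div (q b : ℕ) (hq : 0 < q) (hb : 1 ≤ b) :
    (((b - 1) / q : ℕ) : ℤ) = ((b / q : ℕ) : ℤ) - ind (b % q = 0) := by
  have h := Nat.div_add_mod b q
  have hr := Nat.mod_lt b hq
  rcases Nat.eq_zero_or_pos (b % q) with h0 | hpos
  · have hk : 1 ≤ b / q := by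
      by_contra hk
      have hz : b / q = 0 := Nat.lt_one_iff.mp (Nat.lt_of_not_le hk)
      rw [hz, h0] at h
      omega
    have hm := Nat.mul_le_mul_left q hk
    have e : b - 1 = q * (b / q - 1) + (q - 1) := by
      have := Nat.mul_sub_one q (b / q)
      omega
    rw [e, cdiv1 q _ _ hq (by omega), Nat.cast_sub hk, h0]
    unfold ind
    simp
  · have e : b - 1 = q * (b / q) + (b % q - 1) := by omega
    rw [e, cdiv1 q _ _ hq (by omega)]
    unfold ind
    split_ifs <;> omega

/-- `⌊(a−1)/q⌋ − ⌊(2a−1)/q⌋ = −⌊a/q⌋ − θ(a/q)` for `q` odd, `a ≥ 1` (the `(2a)!/a!`-type bricks shifted by one). -/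
lemma pred_divs (q a : ℕ) (hq : 0 < q) (hodd : q % 2 = 1) (ha : 1 ≤ a) :
    (((a - 1) / q : ℕ) : ℤ) - (((2 * a - 1) / q : ℕ) : ℤ) = -((a / q : ℕ) : ℤ) - th q (a % q) := by
  have h := Nat.div_add_mod a q
  have hr := Nat.mod_lt a hq
  have hmul : q * (2 * (a / q)) = 2 * (q * (a / q)) := by ring
  rcases Nat.eq_zero_or_pos (a % q) with h0 | hpos
  · have hk : 1 ≤ a / q := by
      by_contra hk
      have hz : a / q = 0 := Nat.lt_one_iff.mp (Nat.lt_of_not_le hk)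
      rw [hz, h0] at h
      omega
    have hm := Nat.mul_le_mul_left q hk
    have e1 : a - 1 = q * (a / q - 1) + (q - 1) := by
      have := Nat.mul_sub_one q (a / q)
      omega
    have e2 : 2 * a - 1 = q * (2 * (a / q) - 1) + (q - 1) := by
      have := Nat.mul_sub_one q (2 * (a / q))
      omega
    rw [e1, e2, cdiv1 q _ _ hq (by omega), cdiv1 q _ _ hq (by omega), Nat.cast_sub hk,
      Nat.cast_sub (show 1 ≤ 2 * (a / q) by omega), h0]
    unfold th ind
    push_cast
    split_ifs <;> omega
  · have e1 : a - 1 = q * (a / q) + (a % q - 1) := by omega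
    have e2 : 2 * a - 1 = q * (2 * (a / q)) + (2 * (a % q) - 1) := by omega
    rw [e1, e2, cdiv1 q _ _ hq (by omega), cdiv4 q _ _ hq (by omega)]
    unfold th ind
    push_cast
    split_ifs <;> omega

/-- Residue identity behind type β: `θ({ν−α}) − ⌊2ν−α⌋` in the additive parametrisation `n = a + b`. -/
lemma resid_H (q A B : ℕ) (hq : 0 < q) :
    thSub q ((A + B) % q) (A % q) - carry2 q ((A + B) % q) (A % q)
      = 2 * ind (q ≤ A % q + B % q) - ind (q ≤ A % q + (2 * B) % q) := by
  have hrA := Nat.mod_lt A hq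
  have hrB := Nat.mod_lt B hq
  rw [add_mod_wrap q A B hq, two_mul_mod_wrap q B hq]
  unfold thSub carry2 ind
  by_cases hc : A % q + B % q < q
  · simp only [hc, if_true]
    split_ifs <;> omega
  · simp only [hc, if_false]
    split_ifs <;> omega

/-- Residue identity behind type γ (`a = n + b`): `θ({α−ν}) + ⌊2ν−α⌋ + [α = ν]` additively. -/
lemma resid_G (q n b : ℕ) (hq : 0 < q) :
    thSub q ((n + b) % q) (n % q) + carry2 q (n % q) ((n + b) % q) + ind ((n + b) % q = n % q)
      = th q (b % q) + ind (b % q = 0) - ind (n % q < b % q) + ind (q ≤ n % q + b % q) := by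
  have hrn := Nat.mod_lt n hq
  have hrb := Nat.mod_lt b hq
  rw [add_mod_wrap q n b hq]
  unfold thSub carry2 th ind
  by_cases hc : n % q + b % q < q
  · simp only [hc, if_true]
    split_ifs <;> omega
  · simp only [hc, if_false]
    split_ifs <;> omega

/-- Floor form of the type-β digit function at level `q` (CATK6 §4: bricks `(2n)!/n!`, `(2X)!n!/(X!(X−n)!)·…`,
`(2n−2a)!/((n−a)!)²`, `(a−1)!`, `1/(2n−a)!`, `1/(2a−1)!`). -/
def HdigFloor (q n a X : ℕ) : ℤ :=
  (((2 * n) / q : ℕ) : ℤ) - ((n / q : ℕ) : ℤ) + (((2 * X) / q : ℕ) : ℤ) - ((X / q : ℕ) : ℤ)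
    - (((X - n) / q : ℕ) : ℤ) + (((2 * n - 2 * a) / q : ℕ) : ℤ) - 2 * (((n - a) / q : ℕ) : ℤ)
    + (((a - 1) / q : ℕ) : ℤ) - (((2 * n - a) / q : ℕ) : ℤ) - (((2 * a - 1) / q : ℕ) : ℤ)

/-- Legendre transcription, type β (CATK6 §4): for `q` odd and `1 ≤ a ≤ n ≤ X` the floor form equals `Hdig` of the
residues. -/
theorem HdigFloor_eq (q n a X : ℕ) (hq : 0 < q) (hodd : q % 2 = 1) (ha : 1 ≤ a) (han : a ≤ n) (hnX : n ≤ X) :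
    HdigFloor q n a X = Hdig q (n % q) (a % q) (X % q) := by
  obtain ⟨b, rfl⟩ := Nat.exists_eq_add_of_le han
  obtain ⟨e, rfl⟩ := Nat.exists_eq_add_of_le hnX
  have s1 : a + b + e - (a + b) = e := Nat.add_sub_cancel_left _ _
  have s2 : 2 * (a + b) - 2 * a = 2 * b := by omega
  have s3 : a + b - a = b := Nat.add_sub_cancel_left _ _
  have s4 : 2 * (a + b) - a = a + 2 * b := by omega
  unfold HdigFloor
  rw [s1, s2, s3, s4]
  have h1 := two_mul_div q (a + b) hq
  have h2 := two_mul_div q (a + b + e) hq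
  have h3 := add_div_cast q (a + b) e hq
  have h4 := wrap_lt q (a + b) e hq
  have h5 := two_mul_div q b hq
  have h6 := pred_divs q a hq hodd ha
  have h7 := add_div_cast q a (2 * b) hq
  have h8 := add_div_cast q a b hq
  have h9 := resid_H q a b hq
  unfold Hdig
  linarith

/-- Floor form of the type-γ digit function at level `q` (CATK6 §4). -/
def GdigFloor (q n a X : ℕ) : ℤ :=
  (((2 * n) / q : ℕ) : ℤ) - ((n / q : ℕ) : ℤ) + (((2 * X) / q : ℕ) : ℤ) - ((X / q : ℕ) : ℤ)
    - (((X - n) / q : ℕ) : ℤ) + (((a - n) / q : ℕ) : ℤ) + (((a - n - 1) / q : ℕ) : ℤ) + (((a - 1) / q : ℕ) : ℤ)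
    - (((2 * a - 2 * n) / q : ℕ) : ℤ) - (((2 * n - a) / q : ℕ) : ℤ) - (((2 * a - 1) / q : ℕ) : ℤ)

/-- Legendre transcription, type γ (CATK6 §4): for `q` odd and `n < a ≤ 2n`, `n ≤ X`, the floor form equals `Gdig`
of the residues. -/
theorem GdigFloor_eq (q n a X : ℕ) (hq : 0 < q) (hodd : q % 2 = 1) (hna : n < a) (ha2 : a ≤ 2 * n)
    (hnX : n ≤ X) : GdigFloor q n a X = Gdig q (n % q) (a % q) (X % q) := by
  obtain ⟨b, rfl⟩ := Nat.exists_eq_add_of_le hna.le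
  have hb : 1 ≤ b := by omega
  obtain ⟨g, rfl⟩ := Nat.exists_eq_add_of_le (show b ≤ n by omega)
  obtain ⟨e, rfl⟩ := Nat.exists_eq_add_of_le hnX
  have s1 : b + g + e - (b + g) = e := Nat.add_sub_cancel_left _ _
  have s2 : b + g + b - (b + g) = b := Nat.add_sub_cancel_left _ _
  have s3 : 2 * (b + g + b) - 2 * (b + g) = 2 * b := by omega
  have s4 : 2 * (b + g) - (b + g + b) = g := by omega
  unfold GdigFloor
  rw [s1, s2, s3, s4]
  have h1 := two_mul_div q (b + g) hq
  have h2 := two_mul_div q (b + g + e) hq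
  have h3 := add_div_cast q (b + g) e hq
  have h4 := wrap_lt q (b + g) e hq
  have h5 := two_mul_div q b hq
  have h6 := pred_divs q (b + g + b) hq hodd (by omega)
  have h7 := add_div_cast q (b + g) b hq
  have h8 := add_div_cast q b g hq
  have h9 := pred_div q b hq hb
  have h10 := wrap_lt q b g hq
  have h11 := resid_G q (b + g) b hq
  unfold Gdig
  linarith

/-- Floor-form corollaries (what the assembly of CATK6 §5 consumes): per level, type β is `≥ 0` (H0) and type γ is
`≥ −1` (G1); the sharper F1/F2/H1/G0 transfer the same way through `FdigFloor_eq`/`HdigFloor_eq`/`GdigFloor_eq`. -/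
theorem HdigFloor_nonneg (q n a X : ℕ) (hq : 0 < q) (hodd : q % 2 = 1) (ha : 1 ≤ a) (han : a ≤ n)
    (hnX : n ≤ X) : 0 ≤ HdigFloor q n a X := by
  rw [HdigFloor_eq q n a X hq hodd ha han hnX]
  exact H0 q _ _ _ (Nat.mod_lt _ hq) (Nat.mod_lt _ hq) (Nat.mod_lt _ hq)

/-- Type γ, one level `q` (odd): the digit function is `≥ −1` for `n < a ≤ 2n`, `n ≤ X`. -/
theorem GdigFloor_ge_neg_one (q n a X : ℕ) (hq : 0 < q) (hodd : q % 2 = 1) (hna : n < a) (ha2 : a ≤ 2 * n)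
    (hnX : n ≤ X) : -1 ≤ GdigFloor q n a X := by
  rw [GdigFloor_eq q n a X hq hodd hna ha2 hnX]
  exact G1 q _ _ _ (Nat.mod_lt _ hq) (Nat.mod_lt _ hq) (Nat.mod_lt _ hq)

end Summit.KontsevichZagierPeriods.Zeta5Search.Denom.CatalanRayDigits
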